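import Literature.NumberTheory.Automorphic.WhittakerTowerChain
import Literature.NumberTheory.Automorphic.WhittakerTowerBridge
import Literature.NumberTheory.Automorphic.AdeleQuotientParseval
import Literature.NumberTheory.Automorphic.RankinSelbergTowerComparison
import Literature.NumberTheory.Automorphic.RankinSelbergEisensteinWeight
import HarnessLib

/-!
# The Whittaker tower, IV: Parseval along the tower and the EXACT unfolding chain
`I^{(0)} = I^{(1)} = ⋯ = I^{(n-1)}` for cusp forms (Jacquet–Shalika (1981), §4; Cogdell (2004), §2.3,
Thm. 2.1: `I(s; φ, φ', Φ) = Ψ(s; W_φ, W_{φ'}, Φ)`, here for `φ' = φ̄` at a real point)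

Topic `NumberTheory/Automorphic`; namespace `Literature.NumberTheory.Automorphic`. Proof file
(theorems only: no definition, no named fact, no instance). `WhittakerTowerChain` proves the
**inequality** chain `I^{(d-1)} ≤ I^{(d)}` of the real-point Rankin–Selberg method
(`towerIntegral_pred_le`: unfold the covering weight, **Bessel** on `Y_d(K) \ Y_d(𝔸_K)`, refold), for
an arbitrary continuous left `GL_n(K)`-invariant `φ` — enough for Jacquet–Shalika's Theorem (5.3)
(`RankinSelbergTowerFiniteness`). For the Rankin–Selberg unfolding IDENTITY one needs equality, i.e.
**Parseval** at each stage, and Parseval needs the vanishing of the zero Fourier coefficient, i.e.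
**cuspidality**. Both inputs are in the tree: Parseval on `K^ι \ 𝔸_K^ι` (`AdeleQuotientParseval`) and
the vanishing of the constant column coefficient of every level of the tower of a cusp form
(`colCoeff_zero_eq_zero_of_towerCusp`, `stageHyp_fwTower'` of `CuspTowerColumn`/`CuspidalTowerGeneric`,
for the second formalisation `fwTower` of the tower, identified with `whittakerDepth` by
`whittakerDepth_eq_fwTower` of `WhittakerTowerBridge`). This file draws the consequences, for every `n`:

* `hasSum_norm_sq_boxCoeff` — **Parseval in box form** on the column group `Y_c(𝔸_K)`: for `F`
  continuous and `Y_c(K)`-invariant and every Haar measure `μ_Y`,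
  `Σ_η ‖μ_Y(box)⁻¹ ∫_{box} conj ψ_η F dμ_Y‖² = μ_Y(box)⁻¹ ∫_{box} ‖F‖² dμ_Y` (the equality case of
  `tsum_norm_sq_boxCoeff_le`, `ColumnGroupFourier`);
* `inv_smul_setIntegral_box_comp_mul_eq_colCoeff_zero` — the normalised box integral of `y ↦ f(y g)`
  over the Tate box of `Y_{c+1}(𝔸_K)` is the constant column coefficient `colCoeff _ ν f 0 g` of
  `MirabolicFourierStage` (the dictionary of `colTransform_succ_eq_colCoeff` at the trivial character);
* `setIntegral_box_whittakerDepth_eq_zero` — for `φ` continuous, left `GL_n(K)`-invariant and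
  **cuspidal** (`CuspConditionGL n K φ k`, `0 < k < n`) and `1 ≤ d ≤ n - 1`:
  `∫_{box} Φ_d(y x) dμ(y) = 0` — the constant term of `Φ_d` along `Y_d` vanishes (Cogdell (2004),
  proof of Thm. 1.1: it contains the constant term of `φ` along `U_{(d, n-d)}`);
* `tsum_sq_whittakerDepth_pred_eq` — **the pointwise Parseval identity**
  `Σ_{η ≠ 0} ‖Φ_{d-1}(s_η x)‖² = μ(box)⁻¹ ∫_{box} ‖Φ_d(y x)‖² dμ(y)` (equality in
  `tsum_sq_whittakerDepth_pred_le`);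
* `towerIntegral_pred_eq`, `towerIntegral_eq_top`, `towerIntegral_zero_eq` — **the exact chain**
  `I^{(d-1)} = I^{(d)}` and `I^{(0)} = ∫ ‖φ‖² w β_{n-1} dν` for cuspidal `φ` (same unfolding/refolding
  as `towerIntegral_pred_le`, with Parseval in the middle);
* `lintegral_towerFun_zero_rsWeight_eq_lintegral_eisensteinWeight`,
  `exists_mul_rankinSelbergTorusIntegral_eq_lintegral_eisensteinWeight` (**main**) — **the Rankin–Selberg
  unfolding identity at a real point**, for every `n ≥ 1`: with the weight
  `w = rsWeight Φ σ = Φ(e_n g) |det g|^σ` (`Φ ≥ 0`) and its incomplete Eisenstein sum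
  `E_w = eisensteinWeight Φ σ` (`RankinSelbergEisensteinWeight`),
  `C · rankinSelbergTorusIntegral νA νK W_φ Φ σ = ∫ ‖φ‖² E_w β_{GL_n(K)} dν`
  in `[0, ∞]`, `W_φ = whittakerCoeff` the global Whittaker coefficient, `C ∈ (0, ∞)` the Iwasawa
  constant of `RankinSelbergTowerComparison` (independent of `φ`, `Φ`, `σ`), for every continuous,
  left `GL_n(K)`-invariant cuspidal `φ` — Cogdell's `I(s; φ, φ̄, Φ) = Ψ(s; W_φ, W̄_φ, Φ)` (Thm. 2.1)
  before the integration over the centre, in the tree's covering-weight form; the mean-square method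
  had only `≤` here (`rankinSelbergTorusIntegral_whittakerCoeff_ne_top`).

Everything is proved; no sorry, no new definition.

## References

* H. Jacquet, J. A. Shalika, *On Euler products and the classification of automorphic
  representations I*, Amer. J. Math. 103 (1981), 499–558, §4 [JacquetShalikaAJM1981].
* J. W. Cogdell, *Analytic theory of L-functions for GL_n*, in J. Bernstein, S. Gelbart (eds.), *An
  Introduction to the Langlands Program* (2004), §1.1 (Thm. 1.1 and its proof), §2.3 (Thm. 2.1)
  (PDF pp. 176–177, 186–188 of the held copy) [CogdellAnalyticTheory2004].
* A. Deitmar, S. Echterhoff, *Principles of Harmonic Analysis* (2014), Cor. 3.4.9 (Parseval)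
  [DeitmarEchterhoff2014].
-/

noncomputable section

open MeasureTheory Measure NumberField IsDedekindDomain Matrix Set Filter Topology
open scoped MatrixGroups ENNReal NNReal ComplexConjugate
open Literature.MeasureTheory.Group

namespace Literature.NumberTheory.Automorphic

/-! ### Parseval in box form on the column groups -/

section BoxParseval

variable {n : ℕ} {K : Type} [Field K] [NumberField K] (c : ℕ)
variable [MeasurableSpace (GL (Fin n) (AdeleRing (𝓞 K) K))] [BorelSpace (GL (Fin n) (AdeleRing (𝓞 K) K))]
  [MeasurableSpace (AdeleRing (𝓞 K) K)] [BorelSpace (AdeleRing (𝓞 K) K)]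

/-- **Parseval's identity in box form.** Let `μ_Y` be a Haar measure of the column group `Y_c(𝔸_K)`
(`c < n`), `F : Y_c(𝔸_K) → ℂ` continuous and invariant under left multiplication by the lattice
`Y_c(K)`. Then the squared normalised box Fourier coefficients
`‖μ_Y(box)⁻¹ ∫_{box} conj ψ_η(y) F(y) dμ_Y‖²`, `η : ColIdx n c → K`, sum to `μ_Y(box)⁻¹ ∫_{box} ‖F‖² dμ_Y`
— the equality case of Bessel's inequality `tsum_norm_sq_boxCoeff_le`: in the column coordinates
`x ↦ colVec x` (`μ_Y = a · colVec_*(⊗λ)`, `haar_eq_smul_map_colVec`; the constant `a` cancels in the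
normalised averages) it is Parseval on `K^ι \ 𝔸_K^ι`
(`AdeleRing.hasSum_norm_sq_inv_smul_setIntegral_piFundamentalDomain`). [cite: DeitmarEchterhoff2014, Cor. 3.4.9] -/
theorem hasSum_norm_sq_boxCoeff (hc : c < n) (μY : Measure ↥(adelicColRange n K c c)) [IsHaarMeasure μY]
    {F : ↥(adelicColRange n K c c) → ℂ} (hFc : Continuous F)
    (hF : ∀ γ : ↥(adelicColRange n K c c), γ ∈ rationalColRange n K c c → ∀ y, F (γ * y) = F y) :
    HasSum (fun η : ColIdx n c → K => ‖(μY (colRangeTateDomain n K c c)).toReal⁻¹ •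
        ∫ y in colRangeTateDomain n K c c, conj (colChar (n := n) (K := K) c hc η y : ℂ) * F y ∂μY‖ ^ 2)
      ((μY (colRangeTateDomain n K c c)).toReal⁻¹ * ∫ y in colRangeTateDomain n K c c, ‖F y‖ ^ 2 ∂μY) := by
  haveI := locallyCompactSpace_adeleRing' K
  haveI := secondCountableTopology_adeleRing K
  haveI := t2Space_adeleRing K
  haveI : BorelSpace (ColIdx n c → AdeleRing (𝓞 K) K) := Pi.borelSpace
  set lam : Measure (AdeleRing (𝓞 K) K) := Measure.addHaar with hlam
  obtain ⟨a, ha0, ha, hμ⟩ := haar_eq_smul_map_colVec (n := n) (K := K) c hc lam μY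
  set E := colVecHomeomorph (n := n) (K := K) c hc with hE
  have hEm : MeasurableEmbedding E := E.toMeasurableEquiv.measurableEmbedding
  set P : Measure (ColIdx n c → AdeleRing (𝓞 K) K) := Measure.pi fun _ : ColIdx n c => lam with hP
  have hDm : MeasurableSet (piFundamentalDomain K (ColIdx n c)) := measurableSet_piFundamentalDomain K _
  have hbox : colRangeTateDomain n K c c = E '' piFundamentalDomain K (ColIdx n c) :=
    (image_colVecHomeomorph_pi c hc).symm
  -- the periodic function in coordinates
  set G : (ColIdx n c → AdeleRing (𝓞 K) K) → ℂ := fun x => F (colVecY c x) with hG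
  have hGc : Continuous G := hFc.comp E.continuous
  have hGper : ∀ (x : ColIdx n c → AdeleRing (𝓞 K) K) (ξ : ColIdx n c → K),
      G (x + fun i => algebraMap K (AdeleRing (𝓞 K) K) (ξ i)) = G x := by
    intro x ξ
    simp only [hG]
    rw [add_comm, colVecY_add c hc]
    exact hF _ (colVecY_algebraMap_mem c hc ξ) _
  have hpar := AdeleRing.hasSum_norm_sq_inv_smul_setIntegral_piFundamentalDomain K (ColIdx n c) P hGc hGper
  -- box integrals in coordinates
  have hint : ∀ {E' : Type} [NormedAddCommGroup E'] [NormedSpace ℝ E'] (H : ↥(adelicColRange n K c c) → E'),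
      ∫ y in colRangeTateDomain n K c c, H y ∂μY =
        a.toReal • ∫ x in piFundamentalDomain K (ColIdx n c), H (colVecY c x) ∂P := by
    intro E' _ _ H
    rw [hμ, Measure.restrict_smul, integral_smul_measure, hbox, hEm.restrict_map, hEm.integral_map,
      Set.preimage_image_eq _ E.injective]
    rfl
  have hvol : (μY (colRangeTateDomain n K c c)).toReal =
      a.toReal * (P (piFundamentalDomain K (ColIdx n c))).toReal := by
    rw [hμ, Measure.smul_apply, hbox, Measure.map_apply E.continuous.measurable (hEm.measurableSet_image.2 hDm),
      Set.preimage_image_eq _ E.injective, smul_eq_mul, ENNReal.toReal_mul]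
  have ha' : a.toReal ≠ 0 := ENNReal.toReal_ne_zero.2 ⟨ha0, ha⟩
  -- compare term by term
  have hcoef : ∀ η : ColIdx n c → K, (μY (colRangeTateDomain n K c c)).toReal⁻¹ •
      ∫ y in colRangeTateDomain n K c c, conj (colChar (n := n) (K := K) c hc η y : ℂ) * F y ∂μY =
      ((P (piFundamentalDomain K (ColIdx n c))).toReal⁻¹ : ℝ) •
        ∫ x in piFundamentalDomain K (ColIdx n c),
          conj (adeleAddChar K (∑ i, algebraMap K (AdeleRing (𝓞 K) K) (η i) * x i) : ℂ) * G x ∂P := by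
    intro η
    rw [hint, hvol, mul_inv, smul_smul, mul_comm (a.toReal⁻¹), mul_assoc, inv_mul_cancel₀ ha', mul_one]
    congr 1
    refine setIntegral_congr_fun hDm fun x _ => ?_
    simp only [hG]
    rw [colChar_colVecY c hc]
  have hnorm : (μY (colRangeTateDomain n K c c)).toReal⁻¹ * ∫ y in colRangeTateDomain n K c c, ‖F y‖ ^ 2 ∂μY =
      (P (piFundamentalDomain K (ColIdx n c))).toReal⁻¹ *
        ∫ x in piFundamentalDomain K (ColIdx n c), ‖G x‖ ^ 2 ∂P := by
    rw [hint (fun y => ‖F y‖ ^ 2), hvol, mul_inv, smul_eq_mul, mul_mul_mul_comm, inv_mul_cancel₀ ha', one_mul]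
  simp_rw [hcoef]
  rw [hnorm]
  exact hpar

end BoxParseval

/-! ### The constant column coefficient of the levels of the tower of a cusp form vanishes -/

section ZeroCoefficient

variable {n : ℕ} {K : Type} [Field K] [NumberField K]
variable [MeasurableSpace (AdeleRing (𝓞 K) K)] [BorelSpace (AdeleRing (𝓞 K) K)]
variable [MeasurableSpace (GL (Fin n) (AdeleRing (𝓞 K) K))] [BorelSpace (GL (Fin n) (AdeleRing (𝓞 K) K))]

/-- **The normalised box integral along `Y_{c+1}` is the constant column coefficient**: for
`c + 1 < n`, `f : GL_n(𝔸_K) → ℂ`, `g ∈ GL_n(𝔸_K)` and every additive Haar measure `ν` on `𝔸_K^{c+1}`,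
`μ(box)⁻¹ ∫_{box} f(y g) dμ(y) = colCoeff _ ν f 0 g` (`μ = Measure.haar` on `Y_{c+1}(𝔸_K)`): the dictionary
of `colTransform_succ_eq_colCoeff` (`WhittakerTowerBridge`) at the trivial character — every Haar
measure of `Y_{c+1}(𝔸_K)` is a multiple of the transported product measure, the multiple cancels, and
the product measure is reindexed along `Fin.castLEOrderIso`. [folklore] -/
theorem inv_smul_setIntegral_box_comp_mul_eq_colCoeff_zero {c : ℕ} (hc : c + 1 < n)
    (f : GL (Fin n) (AdeleRing (𝓞 K) K) → ℂ) (g : GL (Fin n) (AdeleRing (𝓞 K) K))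
    (ν : Measure (Fin (c + 1) → AdeleRing (𝓞 K) K)) [ν.IsAddHaarMeasure] :
    ((Measure.haar (G := ↥(adelicColRange n K (c + 1) (c + 1)))) (colRangeTateDomain n K (c + 1) (c + 1))).toReal⁻¹ •
      ∫ y in colRangeTateDomain n K (c + 1) (c + 1), f ((y : GL (Fin n) (AdeleRing (𝓞 K) K)) * g)
        ∂(Measure.haar (G := ↥(adelicColRange n K (c + 1) (c + 1)))) =
      colCoeff hc.le ν f 0 g := by
  haveI := locallyCompactSpace_adeleRing' K
  haveI := secondCountableTopology_adeleRing K
  haveI := t2Space_adeleRing K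
  haveI : BorelSpace (Fin (c + 1) → AdeleRing (𝓞 K) K) := Pi.borelSpace
  haveI : BorelSpace (ColIdx n (c + 1) → AdeleRing (𝓞 K) K) := Pi.borelSpace
  -- a product Haar measure on the coordinates
  obtain ⟨lam, hlam⟩ : ∃ lam : Measure (AdeleRing (𝓞 K) K), lam.IsAddHaarMeasure := ⟨Measure.addHaar, inferInstance⟩
  rw [colCoeff_eq_of_isAddHaarMeasure hc.le (Measure.pi fun _ : Fin (c + 1) => lam) ν, colCoeff_apply]
  -- the trivial character
  have hchar : ∀ v : Fin (c + 1) → AdeleRing (𝓞 K) K,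
      conj (adeleAddChar K (∑ i, algebraMap K (AdeleRing (𝓞 K) K) ((0 : Fin (c + 1) → K) i) * v i) : ℂ) = 1 := by
    intro v
    simp
  simp_rw [hchar, one_mul]
  -- Haar measure of `Y_{c+1}(𝔸_K)` in coordinates
  obtain ⟨a, ha0, ha, hμ⟩ := haar_eq_smul_map_colVec (n := n) (K := K) (c + 1) hc lam
    (Measure.haar : Measure ↥(adelicColRange n K (c + 1) (c + 1)))
  set E := colVecHomeomorph (n := n) (K := K) (c + 1) hc with hE
  have hEm : MeasurableEmbedding E := E.toMeasurableEquiv.measurableEmbedding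
  have hDm : MeasurableSet (Set.pi Set.univ fun _ : ColIdx n (c + 1) => adeleFundamentalDomain K) :=
    MeasurableSet.univ_pi fun _ => measurableSet_adeleFundamentalDomain K
  have hbox : colRangeTateDomain n K (c + 1) (c + 1) =
      E '' Set.pi Set.univ (fun _ : ColIdx n (c + 1) => adeleFundamentalDomain K) :=
    (image_colVecHomeomorph_pi (c + 1) hc).symm
  -- the reindexing `R : 𝔸^{Fin (c+1)} → 𝔸^{ColIdx}` preserves the product measures and the boxes
  obtain ⟨Rm, hRm⟩ : ∃ Rm : (Fin (c + 1) → AdeleRing (𝓞 K) K) ≃ᵐ (ColIdx n (c + 1) → AdeleRing (𝓞 K) K),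
      Rm = MeasurableEquiv.piCongrLeft (fun _ : ColIdx n (c + 1) => AdeleRing (𝓞 K) K) ((Fin.castLEOrderIso hc.le).toEquiv) :=
    ⟨_, rfl⟩
  have hRmp : MeasurePreserving Rm (Measure.pi fun _ : Fin (c + 1) => lam)
      (Measure.pi fun _ : ColIdx n (c + 1) => lam) := by
    rw [hRm]
    exact measurePreserving_piCongrLeft (fun _ : ColIdx n (c + 1) => lam) ((Fin.castLEOrderIso hc.le).toEquiv)
  have hRme : MeasurableEmbedding Rm := Rm.measurableEmbedding
  have hRpre : Rm ⁻¹' Set.pi Set.univ (fun _ : ColIdx n (c + 1) => adeleFundamentalDomain K) =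
      piFundamentalDomain K (Fin (c + 1)) := by
    rw [hRm, MeasurableEquiv.coe_piCongrLeft, Equiv.piCongrLeft_preimage_univ_pi]
    rfl
  -- the two matrices agree along `R`
  have hmat : ∀ v : Fin (c + 1) → AdeleRing (𝓞 K) K,
      ((E (Rm v) : ↥(adelicColRange n K (c + 1) (c + 1))) : GL (Fin n) (AdeleRing (𝓞 K) K)) =
        colUnipotent n hc.le (Multiplicative.ofAdd v) := by
    intro v
    rw [hE, colVecHomeomorph_apply, coe_colVecY, colVecGL_eq_colUnipotent hc.le]
    congr 2
    funext i
    rw [hRm]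
    exact MeasurableEquiv.piCongrLeft_apply_apply ((Fin.castLEOrderIso hc.le).toEquiv) (β := fun _ => AdeleRing (𝓞 K) K) v i
  -- box volume and box integral in coordinates
  have hvol : (Measure.haar : Measure ↥(adelicColRange n K (c + 1) (c + 1))) (colRangeTateDomain n K (c + 1) (c + 1)) =
      a * (Measure.pi fun _ : Fin (c + 1) => lam) (piFundamentalDomain K (Fin (c + 1))) := by
    rw [hμ, Measure.smul_apply, hbox, Measure.map_apply E.continuous.measurable (hEm.measurableSet_image.2 hDm),
      Set.preimage_image_eq _ E.injective, smul_eq_mul, ← hRpre, hRmp.measure_preimage_emb hRme]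
  have hint : ∫ y in colRangeTateDomain n K (c + 1) (c + 1),
      f ((y : GL (Fin n) (AdeleRing (𝓞 K) K)) * g)
      ∂(Measure.haar : Measure ↥(adelicColRange n K (c + 1) (c + 1))) =
      a.toReal • ∫ v in piFundamentalDomain K (Fin (c + 1)),
        f (colUnipotent n hc.le (Multiplicative.ofAdd v) * g) ∂(Measure.pi fun _ : Fin (c + 1) => lam) := by
    rw [hμ, Measure.restrict_smul, integral_smul_measure, hbox, hEm.restrict_map, hEm.integral_map,
      Set.preimage_image_eq _ E.injective, ← hRmp.setIntegral_preimage_emb hRme, hRpre]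
    congr 1
    refine setIntegral_congr_fun (measurableSet_piFundamentalDomain K (Fin (c + 1))) fun v _ => ?_
    simp only [hmat v]
  have ha' : a.toReal ≠ 0 := ENNReal.toReal_ne_zero.2 ⟨ha0, ha⟩
  rw [hint, hvol, ENNReal.toReal_mul, mul_inv, smul_smul]
  congr 1
  rw [mul_comm ((a.toReal)⁻¹), mul_assoc, inv_mul_cancel₀ ha', mul_one]

/-- **The constant term of `Φ_d` along `Y_d` vanishes for a cusp form.** Let `φ : GL_n(𝔸_K) → ℂ` be
continuous, left `GL_n(K)`-invariant and cuspidal (`CuspConditionGL n K φ k` for `0 < k < n`), and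
`1 ≤ d ≤ n - 1`. Then `∫_{box} Φ_d(y x) dμ(y) = 0` for the Haar measure `μ = Measure.haar` of `Y_d(𝔸_K)`, its
Tate box and every `x`: by `inv_smul_setIntegral_box_comp_mul_eq_colCoeff_zero` and
`whittakerDepth_eq_fwTower` this is the constant column coefficient of the level `fwTower ν φ d` of the
second tower, which vanishes by `colCoeff_zero_eq_zero_of_towerCusp` (the cusp invariant descends the
tower, `stageHyp_fwTower'`; Cogdell (2004), proof of Thm. 1.1: the `η = 0` coefficient contains the
constant term of `φ` along the unipotent radical `U_{(d, n-d)}`). [cite: CogdellAnalyticTheory2004, §1.1 Thm. 1.1 (proof)] -/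
theorem setIntegral_box_whittakerDepth_eq_zero {φ : GL (Fin n) (AdeleRing (𝓞 K) K) → ℂ} (hφ : Continuous φ)
    (hφK : ∀ (γ₀ : GL (Fin n) K) (x : GL (Fin n) (AdeleRing (𝓞 K) K)),
      φ (Matrix.GeneralLinearGroup.map (algebraMap K (AdeleRing (𝓞 K) K)) γ₀ * x) = φ x)
    (hcusp : ∀ k, 0 < k → k < n → CuspConditionGL n K φ k)
    {d : ℕ} (hd0 : 0 < d) (hd : d + 1 ≤ n) (x : GL (Fin n) (AdeleRing (𝓞 K) K)) :
    ∫ y in colRangeTateDomain n K d d, whittakerDepth d φ ((y : GL (Fin n) (AdeleRing (𝓞 K) K)) * x)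
      ∂(Measure.haar (G := ↥(adelicColRange n K d d))) = 0 := by
  haveI := locallyCompactSpace_adeleRing' K
  haveI := secondCountableTopology_adeleRing K
  haveI := t2Space_adeleRing K
  obtain ⟨c, rfl⟩ : ∃ c, d = c + 1 := ⟨d - 1, by omega⟩
  have hc : c + 1 < n := hd
  -- product Haar measures on the coordinate spaces
  obtain ⟨lam, hlam⟩ : ∃ lam : Measure (AdeleRing (𝓞 K) K), lam.IsAddHaarMeasure := ⟨Measure.addHaar, inferInstance⟩
  set ν : ∀ m : ℕ, Measure (Fin m → AdeleRing (𝓞 K) K) := fun m => Measure.pi fun _ : Fin m => lam with hν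
  haveI : ∀ m, (ν m).IsAddHaarMeasure := fun m => by
    haveI : BorelSpace (Fin m → AdeleRing (𝓞 K) K) := Pi.borelSpace
    rw [hν]
    infer_instance
  -- the constant coefficient of the level `c + 1` of the second tower vanishes
  have hG := stageHyp_fwTower' ν hφ (fun δ y => hφK δ y) hcusp hc.le hd
  have h0 : colCoeff hc.le (ν (c + 1)) (fwTower K ν φ (c + 1)) 0 x = 0 :=
    colCoeff_zero_eq_zero_of_towerCusp hc.le hd hG.cusp (ν (c + 1)) x
  rw [← whittakerDepth_eq_fwTower ν φ (c + 1), ← inv_smul_setIntegral_box_comp_mul_eq_colCoeff_zero hc _ x (ν (c + 1)),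
    smul_eq_zero] at h0
  rcases h0 with h0 | h0
  · exfalso
    have hV0 := (measure_colRangeTateDomain_pos_of_isHaarMeasure
      (Measure.haar (G := ↥(adelicColRange n K (c + 1) (c + 1))))).ne'
    have hVtop := (measure_colRangeTateDomain_lt_top (Measure.haar (G := ↥(adelicColRange n K (c + 1) (c + 1))))).ne
    exact (inv_ne_zero (ENNReal.toReal_ne_zero.2 ⟨hV0, hVtop⟩)) h0
  · exact h0

end ZeroCoefficient

/-! ### The pointwise Parseval identity and the exact chain -/

section Chain

variable {n : ℕ} {K : Type} [Field K] [NumberField K]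
variable [MeasurableSpace (GL (Fin n) (AdeleRing (𝓞 K) K))] [BorelSpace (GL (Fin n) (AdeleRing (𝓞 K) K))]

/-- **The pointwise Parseval identity of the Fourier–Whittaker recursion.** For `φ` continuous, left
`GL_n(K)`-invariant and cuspidal, `1 ≤ d < n`, representatives `s_η = diag(B_η, 1)` with low rows `η ≠ 0`,
and every `x`:

  `Σ_{η ≠ 0} ‖Φ_{d-1}(s_η x)‖² = μ(box)⁻¹ ∫_{box} ‖Φ_d(y x)‖² dμ(y)`

in `ℝ≥0∞` (`μ = Measure.haar` on `Y_d(𝔸_K)`): the squared Fourier coefficients of the continuous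
`Y_d(K)`-invariant function `y ↦ Φ_d(y x)` at `η ≠ 0` are the `‖Φ_{d-1}(s_η x)‖²`
(`whittakerDepth_pred_lowCorner_mul`), the coefficient at `η = 0` vanishes by cuspidality
(`setIntegral_box_whittakerDepth_eq_zero`), and Parseval holds in box form (`hasSum_norm_sq_boxCoeff`).
This is the equality case of `tsum_sq_whittakerDepth_pred_le` (Jacquet–Shalika (1981), §4; Cogdell (2004),
§1.1/§2.3). [cite: JacquetShalikaAJM1981, §4] -/
theorem tsum_sq_whittakerDepth_pred_eq {φ : GL (Fin n) (AdeleRing (𝓞 K) K) → ℂ} (hφ : Continuous φ)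
    (hφK : ∀ (γ₀ : GL (Fin n) K) (x : GL (Fin n) (AdeleRing (𝓞 K) K)),
      φ (Matrix.GeneralLinearGroup.map (algebraMap K (AdeleRing (𝓞 K) K)) γ₀ * x) = φ x)
    (hcusp : ∀ k, 0 < k → k < n → CuspConditionGL n K φ k)
    {d : ℕ} (hd : d < n) (hd0 : 0 < d)
    (B : {η : ColIdx n d → K // η ≠ 0} → GL (ColIdx n d) K)
    (hB : ∀ η, lowRow d (lowCornerGL (n := n) (R := K) d (B η)) = η.1)
    (x : GL (Fin n) (AdeleRing (𝓞 K) K)) :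
    ∑' η : {η : ColIdx n d → K // η ≠ 0},
        ENNReal.ofReal (‖whittakerDepth (d - 1) φ
          (Matrix.GeneralLinearGroup.map (algebraMap K (AdeleRing (𝓞 K) K)) (lowCornerGL (n := n) (R := K) d (B η)) * x)‖ ^ 2) =
      ((Measure.haar (G := ↥(adelicColRange n K d d))) (colRangeTateDomain n K d d))⁻¹ *
        ∫⁻ y in colRangeTateDomain n K d d,
          ENNReal.ofReal (‖whittakerDepth d φ ((y : GL (Fin n) (AdeleRing (𝓞 K) K)) * x)‖ ^ 2)
          ∂(Measure.haar (G := ↥(adelicColRange n K d d))) := by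
  -- auxiliary Borel structure on `𝔸_K` for the Fourier analysis on `K^d \ 𝔸_K^d`
  letI : MeasurableSpace (AdeleRing (𝓞 K) K) := borel _
  haveI : BorelSpace (AdeleRing (𝓞 K) K) := ⟨rfl⟩
  set Y := adelicColRange n K d d with hY
  set μ : Measure ↥Y := Measure.haar with hμ
  set box := colRangeTateDomain n K d d with hbox
  set V := μ box with hV
  have hV0 : V ≠ 0 := (measure_colRangeTateDomain_pos_of_isHaarMeasure μ).ne'
  have hVtop : V ≠ ⊤ := (measure_colRangeTateDomain_lt_top μ).ne
  have hVr : 0 < V.toReal := ENNReal.toReal_pos hV0 hVtop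
  -- the function on `Y` and its invariance
  set Fx : ↥Y → ℂ := fun y => whittakerDepth d φ ((y : GL (Fin n) (AdeleRing (𝓞 K) K)) * x) with hFx
  have hFxc : Continuous Fx := (continuous_whittakerDepth hφ d).comp (continuous_subtype_val.mul continuous_const)
  have hFxinv : ∀ γ : ↥Y, γ ∈ rationalColRange n K d d → ∀ y, Fx (γ * y) = Fx y := by
    intro γ hγ y
    simp only [hFx, Subgroup.coe_mul, mul_assoc]
    exact whittakerDepth_rational_colGroup_mul hφK hd γ hγ _
  -- Parseval over all frequencies
  have hpar := hasSum_norm_sq_boxCoeff d hd μ hFxc hFxinv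
  set coef : (ColIdx n d → K) → ℝ := fun η => ‖(V.toReal)⁻¹ •
      ∫ y in box, conj (colChar (n := n) (K := K) d hd η y : ℂ) * Fx y ∂μ‖ ^ 2 with hcoef
  have hpar1 : HasSum coef ((V.toReal)⁻¹ * ∫ y in box, ‖Fx y‖ ^ 2 ∂μ) := hpar
  -- the zero coefficient vanishes (cuspidality)
  have hcoef0 : coef 0 = 0 := by
    have hz : ∫ y in box, Fx y ∂μ = 0 := setIntegral_box_whittakerDepth_eq_zero hφ hφK hcusp hd0 hd x
    have e1 : ∀ y : ↥Y, (colChar (n := n) (K := K) d hd 0 y : ℂ) = 1 := by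
      intro y
      unfold colChar
      simp
    have hz' : ∫ y in box, conj (colChar (n := n) (K := K) d hd 0 y : ℂ) * Fx y ∂μ = 0 := by
      have e2 : ∀ y : ↥Y, conj (colChar (n := n) (K := K) d hd 0 y : ℂ) * Fx y = Fx y := by
        intro y
        rw [e1 y, map_one, one_mul]
      simp_rw [e2]
      exact hz
    simp only [hcoef]
    rw [hz', smul_zero, norm_zero, zero_pow two_ne_zero]
  have hsupp : Function.support coef ⊆ {η | η ≠ 0} := by
    intro η hη h0
    apply hη
    rw [show η = 0 from h0]
    exact hcoef0
  have hpar' : HasSum (fun η : {η : ColIdx n d → K // η ≠ 0} => coef η.1)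
      ((V.toReal)⁻¹ * ∫ y in box, ‖Fx y‖ ^ 2 ∂μ) :=
    (hasSum_subtype_iff_of_support_subset hsupp).2 hpar1
  -- the coefficients at `η ≠ 0` are the values `Φ_{d-1}(s_η x)`
  have hcoef_eq : ∀ η : {η : ColIdx n d → K // η ≠ 0},
      ‖whittakerDepth (d - 1) φ
        (Matrix.GeneralLinearGroup.map (algebraMap K (AdeleRing (𝓞 K) K)) (lowCornerGL (n := n) (R := K) d (B η)) * x)‖ ^ 2 =
        coef η.1 := by
    intro η
    rw [hcoef, whittakerDepth_pred_lowCorner_mul hφK hd hd0 η.1 (B η) (hB η) x]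
  have hnn : ∀ η, 0 ≤ coef η := fun η => by positivity
  calc ∑' η : {η : ColIdx n d → K // η ≠ 0},
        ENNReal.ofReal (‖whittakerDepth (d - 1) φ
          (Matrix.GeneralLinearGroup.map (algebraMap K (AdeleRing (𝓞 K) K)) (lowCornerGL (n := n) (R := K) d (B η)) * x)‖ ^ 2)
      = ∑' η : {η : ColIdx n d → K // η ≠ 0}, ENNReal.ofReal (coef η.1) := by
        refine tsum_congr fun η => ?_; rw [hcoef_eq]
    _ = ENNReal.ofReal (∑' η : {η : ColIdx n d → K // η ≠ 0}, coef η.1) :=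
        (ENNReal.ofReal_tsum_of_nonneg (fun η => hnn _) hpar'.summable).symm
    _ = ENNReal.ofReal ((V.toReal)⁻¹ * ∫ y in box, ‖Fx y‖ ^ 2 ∂μ) := by rw [hpar'.tsum_eq]
    _ = V⁻¹ * ∫⁻ y in box, ENNReal.ofReal (‖Fx y‖ ^ 2) ∂μ := by
        rw [ENNReal.ofReal_mul (inv_nonneg.2 hVr.le), ENNReal.ofReal_inv_of_pos hVr, ENNReal.ofReal_toReal hVtop]
        congr 1
        have hint : IntegrableOn (fun y => ‖Fx y‖ ^ 2) box μ :=
          ((hFxc.norm.pow 2).continuousOn.integrableOn_compact isCompact_closure_colRangeTateDomain).mono_set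
            subset_closure
        rw [ofReal_integral_eq_lintegral_ofReal hint (Eventually.of_forall fun y => by positivity)]

/-- **The exact chain step `I^{(d-1)} = I^{(d)}` for cusp forms.** Let `1 ≤ d < n`, `φ` continuous, left
`GL_n(K)`-invariant and cuspidal (`CuspConditionGL n K φ k`, `0 < k < n`), `w ≥ 0` measurable, left
`N_n(𝔸_K)`- and left `P_n(K)`-invariant, `ν` s-finite and left-invariant, `β` a measurable `Q_d(K)`-covering
weight and `β'` a measurable `Q_{d-1}(K)`-covering weight. Then `∫ ‖Φ_{d-1}‖² w β' dν = ∫ ‖Φ_d‖² w β dν`: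
unfold `β'` to `β` along the representatives `s_η` (`lintegral_mul_eq_lintegral_tsum_mul`), apply the
pointwise Parseval identity `tsum_sq_whittakerDepth_pred_eq`, exchange the integrals, substitute
`x ↦ y⁻¹ x` and remove the `Y_d`-average of `β` (`lintegral_mul_boxAverage_eq`) — the proof of
`towerIntegral_pred_le` with Parseval in place of Bessel (Jacquet–Shalika (1981), §4; Cogdell (2004),
§2.3, the unfolding `I(s; φ, φ', Φ) = Ψ(s; W_φ, W_{φ'}, Φ)` one column at a time).
[cite: JacquetShalikaAJM1981, §4] -/
theorem towerIntegral_pred_eq {φ : GL (Fin n) (AdeleRing (𝓞 K) K) → ℂ} (hφ : Continuous φ)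
    (hφK : ∀ (γ₀ : GL (Fin n) K) (x : GL (Fin n) (AdeleRing (𝓞 K) K)),
      φ (Matrix.GeneralLinearGroup.map (algebraMap K (AdeleRing (𝓞 K) K)) γ₀ * x) = φ x)
    (hcusp : ∀ k, 0 < k → k < n → CuspConditionGL n K φ k)
    {w : GL (Fin n) (AdeleRing (𝓞 K) K) → ℝ≥0∞} (hw : Measurable w)
    (hwU : ∀ u : GL (Fin n) (AdeleRing (𝓞 K) K), u ∈ upperUnitriangular (Fin n) (AdeleRing (𝓞 K) K) → ∀ x, w (u * x) = w x)
    (hwK : ∀ γ₀ : GL (Fin n) K, γ₀ ∈ tailUnipotent n K (n - 1) →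
      ∀ x, w (Matrix.GeneralLinearGroup.map (algebraMap K (AdeleRing (𝓞 K) K)) γ₀ * x) = w x)
    (ν : Measure (GL (Fin n) (AdeleRing (𝓞 K) K))) [SFinite ν] [ν.IsMulLeftInvariant]
    {d : ℕ} (hd : d < n) (hd0 : 0 < d)
    {β : GL (Fin n) (AdeleRing (𝓞 K) K) → ℝ≥0∞} (hβm : Measurable β)
    (hβ : ∀ x, coveringSum ↥(ratPoints (tailUnipotent n K d)) β x = 1)
    {β' : GL (Fin n) (AdeleRing (𝓞 K) K) → ℝ≥0∞} (hβ'm : Measurable β')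
    (hβ' : ∀ x, coveringSum ↥(ratPoints (tailUnipotent n K (d - 1))) β' x = 1) :
    ∫⁻ x, towerFun (d - 1) φ w x * β' x ∂ν = ∫⁻ x, towerFun d φ w x * β x ∂ν := by
  haveI := secondCountableTopology_generalLinearGroup_adeleRing K (Fin n)
  set ι := algebraMap K (AdeleRing (𝓞 K) K) with hι
  set Y := adelicColRange n K d d with hY
  set μ : Measure ↥Y := Measure.haar with hμ
  set box := colRangeTateDomain n K d d with hbox
  set V := μ box with hV
  have hV0 : V ≠ 0 := (measure_colRangeTateDomain_pos_of_isHaarMeasure μ).ne'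
  have hVtop : V ≠ ⊤ := (measure_colRangeTateDomain_lt_top μ).ne
  -- Step 1: unfold `β'` to `β` along the representatives `s_η`
  have hdn : d - 1 < n := by omega
  set Bc := lowCornerChoice (n := n) (F := K) hd0 hdn with hBc
  set s : {η : ColIdx n d → K // η ≠ 0} → GL (Fin n) (AdeleRing (𝓞 K) K) :=
    fun η => Matrix.GeneralLinearGroup.map ι (lowCornerGL (n := n) (R := K) d (Bc η)) with hs
  have hsΓ : ∀ η, s η ∈ ratPoints (tailUnipotent n K d) := fun η =>
    Subgroup.mem_map_of_mem _ (cornerGL_le_tailUnipotent d (lowCornerGL_mem_cornerGL d (Bc η)))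
  have hsU : ∀ γ ∈ ratPoints (tailUnipotent n K d), ∃! η, γ * (s η)⁻¹ ∈ ratPoints (tailUnipotent n K (d - 1)) := by
    intro γ hγ
    obtain ⟨γ₀, hγ₀, rfl⟩ := (mem_ratPoints_iff _ _).1 hγ
    have key : ∀ η, Matrix.GeneralLinearGroup.map ι γ₀ * (s η)⁻¹ ∈ ratPoints (tailUnipotent n K (d - 1)) ↔
        γ₀ * (lowCornerGL (n := n) (R := K) d (Bc η))⁻¹ ∈ tailUnipotent n K (d - 1) := by
      intro η
      rw [hs]
      change Matrix.GeneralLinearGroup.map ι γ₀ * (Matrix.GeneralLinearGroup.map ι _)⁻¹ ∈ _ ↔ _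
      rw [← map_inv, ← map_mul]
      exact Subgroup.mem_map_iff_mem generalLinearGroup_map_algebraMap_injective
    obtain ⟨η₀, hη₀, huniq⟩ := existsUnique_mul_inv_lowCornerGL_mem hd0 hdn Bc (lowRow_lowCornerChoice hd0 hdn) hγ₀
    exact ⟨η₀, (key η₀).2 hη₀, fun η hη => huniq η ((key η).1 hη)⟩
  haveI : Countable {η : ColIdx n d → K // η ≠ 0} := by
    haveI : Countable K := NumberField.countable' (K := K)
    infer_instance
  have hF'm : Measurable (towerFun (d - 1) φ w) := measurable_towerFun _ hφ hw
  have hF'inv : ∀ γ ∈ ratPoints (tailUnipotent n K (d - 1)), ∀ x,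
      towerFun (d - 1) φ w (γ • x) = towerFun (d - 1) φ w x := fun γ hγ x =>
    towerFun_ratPoints_mul (by omega) hφK hwK ⟨γ, hγ⟩ x
  have step1 := lintegral_mul_eq_lintegral_tsum_mul ν (ratPoints (tailUnipotent n K d))
    (ratPoints (tailUnipotent n K (d - 1))) (ratPoints_mono (tailUnipotent_mono (by omega)))
    hF'm hF'inv hβ'm hβ' hβm hβ hsΓ hsU
  rw [step1]
  -- Step 2: the pointwise Parseval identity, times `w β`
  have step2 : ∀ x, (∑' η, towerFun (d - 1) φ w (s η • x)) * β x =
      (w x * (V⁻¹ * ∫⁻ y in box, ENNReal.ofReal (‖whittakerDepth d φ ((y : GL (Fin n) (AdeleRing (𝓞 K) K)) * x)‖ ^ 2) ∂μ)) * β x := by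
    intro x
    congr 1
    have hws : ∀ η, w (s η * x) = w x := fun η =>
      hwK _ (tailUnipotent_mono (by omega) (cornerGL_le_tailUnipotent d (lowCornerGL_mem_cornerGL d (Bc η)))) x
    calc ∑' η, towerFun (d - 1) φ w (s η • x)
        = ∑' η, ENNReal.ofReal (‖whittakerDepth (d - 1) φ (s η * x)‖ ^ 2) * w x := by
          refine tsum_congr fun η => ?_
          rw [smul_eq_mul, towerFun, hws]
      _ = (∑' η, ENNReal.ofReal (‖whittakerDepth (d - 1) φ (s η * x)‖ ^ 2)) * w x := ENNReal.tsum_mul_right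
      _ = (V⁻¹ * ∫⁻ y in box, ENNReal.ofReal (‖whittakerDepth d φ ((y : GL (Fin n) (AdeleRing (𝓞 K) K)) * x)‖ ^ 2) ∂μ) * w x := by
          rw [tsum_sq_whittakerDepth_pred_eq hφ hφK hcusp hd hd0 Bc (lowRow_lowCornerChoice hd0 hdn) x]
      _ = _ := mul_comm _ _
  rw [lintegral_congr step2]
  -- Step 3: exchange, substitute `x ↦ y⁻¹ x`, and recognise the `Y`-average of `β`
  have hHm : Measurable fun g : GL (Fin n) (AdeleRing (𝓞 K) K) => ENNReal.ofReal (‖whittakerDepth d φ g‖ ^ 2) :=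
    ENNReal.measurable_ofReal.comp ((continuous_whittakerDepth hφ d).norm.pow 2).measurable
  have hcont_yx : Continuous fun p : GL (Fin n) (AdeleRing (𝓞 K) K) × ↥Y => (p.2 : GL (Fin n) (AdeleRing (𝓞 K) K)) * p.1 :=
    (continuous_subtype_val.comp continuous_snd).mul continuous_fst
  have hcont_yinvx : Continuous fun p : GL (Fin n) (AdeleRing (𝓞 K) K) × ↥Y => ((p.2 : GL (Fin n) (AdeleRing (𝓞 K) K)))⁻¹ * p.1 :=
    ((continuous_subtype_val.comp continuous_snd).inv).mul continuous_fst
  -- (a) rearrange the integrand and pull out `V⁻¹`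
  have hmI : Measurable fun x : GL (Fin n) (AdeleRing (𝓞 K) K) =>
      ∫⁻ y in box, ENNReal.ofReal (‖whittakerDepth d φ ((y : GL (Fin n) (AdeleRing (𝓞 K) K)) * x)‖ ^ 2) ∂μ :=
    ((hHm.comp hcont_yx.measurable) : Measurable (Function.uncurry fun (x : GL (Fin n) (AdeleRing (𝓞 K) K)) (y : ↥Y) =>
      ENNReal.ofReal (‖whittakerDepth d φ ((y : GL (Fin n) (AdeleRing (𝓞 K) K)) * x)‖ ^ 2))).lintegral_prod_right'
  have ha : ∀ x, w x * (V⁻¹ * ∫⁻ y in box, ENNReal.ofReal (‖whittakerDepth d φ ((y : GL (Fin n) (AdeleRing (𝓞 K) K)) * x)‖ ^ 2) ∂μ) * β x =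
      V⁻¹ * ((∫⁻ y in box, ENNReal.ofReal (‖whittakerDepth d φ ((y : GL (Fin n) (AdeleRing (𝓞 K) K)) * x)‖ ^ 2) ∂μ) * (w x * β x)) := fun x => by ring
  simp_rw [ha]
  have hm1 : Measurable fun x : GL (Fin n) (AdeleRing (𝓞 K) K) =>
      (∫⁻ y in box, ENNReal.ofReal (‖whittakerDepth d φ ((y : GL (Fin n) (AdeleRing (𝓞 K) K)) * x)‖ ^ 2) ∂μ) * (w x * β x) :=
    hmI.mul (hw.mul hβm)
  rw [lintegral_const_mul _ hm1]
  -- (b) `∫_x (∫_{box} H(yx) dy) (w β)(x) = ∫_{box} ∫_x H(yx) (wβ)(x)` (Tonelli)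
  have hb : ∫⁻ x, (∫⁻ y in box, ENNReal.ofReal (‖whittakerDepth d φ ((y : GL (Fin n) (AdeleRing (𝓞 K) K)) * x)‖ ^ 2) ∂μ) * (w x * β x) ∂ν =
      ∫⁻ y in box, ∫⁻ x, ENNReal.ofReal (‖whittakerDepth d φ ((y : GL (Fin n) (AdeleRing (𝓞 K) K)) * x)‖ ^ 2) * (w x * β x) ∂ν ∂μ := by
    have e1 : ∀ x, (∫⁻ y in box, ENNReal.ofReal (‖whittakerDepth d φ ((y : GL (Fin n) (AdeleRing (𝓞 K) K)) * x)‖ ^ 2) ∂μ) * (w x * β x) =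
        ∫⁻ y in box, ENNReal.ofReal (‖whittakerDepth d φ ((y : GL (Fin n) (AdeleRing (𝓞 K) K)) * x)‖ ^ 2) * (w x * β x) ∂μ := fun x =>
      (lintegral_mul_const _ (hHm.comp (continuous_subtype_val.mul continuous_const).measurable)).symm
    simp_rw [e1]
    refine lintegral_lintegral_swap ?_
    exact ((hHm.comp hcont_yx.measurable).mul ((hw.mul hβm).comp measurable_fst)).aemeasurable
  rw [hb]
  -- (c) substitute `x ↦ y⁻¹ x` in the inner integral and use the invariance of `w`
  have hc : ∀ y : ↥Y, ∫⁻ x, ENNReal.ofReal (‖whittakerDepth d φ ((y : GL (Fin n) (AdeleRing (𝓞 K) K)) * x)‖ ^ 2) * (w x * β x) ∂ν =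
      ∫⁻ x, ENNReal.ofReal (‖whittakerDepth d φ x‖ ^ 2) * w x * β (((y : GL (Fin n) (AdeleRing (𝓞 K) K)))⁻¹ * x) ∂ν := by
    intro y
    have e := lintegral_mul_left_eq_self (μ := ν)
      (fun x => ENNReal.ofReal (‖whittakerDepth d φ x‖ ^ 2) * w x * β (((y : GL (Fin n) (AdeleRing (𝓞 K) K)))⁻¹ * x)) (y : GL (Fin n) (AdeleRing (𝓞 K) K))
    rw [← e]
    refine lintegral_congr fun x => ?_
    simp only [inv_mul_cancel_left]
    rw [hwU _ (unipotentColRange_le_upperUnitriangular y.2) x]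
    ring
  simp_rw [hc]
  -- (d) swap back and pull `H w` out of the `y`-integral
  have hd' : ∫⁻ y in box, ∫⁻ x, ENNReal.ofReal (‖whittakerDepth d φ x‖ ^ 2) * w x * β (((y : GL (Fin n) (AdeleRing (𝓞 K) K)))⁻¹ * x) ∂ν ∂μ =
      ∫⁻ x, ENNReal.ofReal (‖whittakerDepth d φ x‖ ^ 2) * w x * ∫⁻ y in box, β (((y : GL (Fin n) (AdeleRing (𝓞 K) K)))⁻¹ * x) ∂μ ∂ν := by
    rw [lintegral_lintegral_swap]
    · refine lintegral_congr fun x => ?_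
      exact lintegral_const_mul _ (hβm.comp ((continuous_subtype_val.inv).mul continuous_const).measurable)
    · exact (((hHm.mul hw).comp measurable_snd).mul (hβm.comp
        (((continuous_subtype_val.comp continuous_fst).inv).mul continuous_snd).measurable)).aemeasurable
  have hm2 : Measurable fun x : GL (Fin n) (AdeleRing (𝓞 K) K) =>
      ENNReal.ofReal (‖whittakerDepth d φ x‖ ^ 2) * w x * ∫⁻ y in box, β (((y : GL (Fin n) (AdeleRing (𝓞 K) K)))⁻¹ * x) ∂μ :=
    (hHm.mul hw).mul
      ((hβm.comp hcont_yinvx.measurable : Measurable (Function.uncurry fun (x : GL (Fin n) (AdeleRing (𝓞 K) K)) (y : ↥Y) =>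
        β (((y : GL (Fin n) (AdeleRing (𝓞 K) K)))⁻¹ * x))).lintegral_prod_right')
  rw [hd', ← lintegral_const_mul _ hm2]
  -- (e) recognise `towerFun d` times the `Y`-average of `β`, and apply (♠)
  have he : ∀ x, V⁻¹ * (ENNReal.ofReal (‖whittakerDepth d φ x‖ ^ 2) * w x * ∫⁻ y in box, β (((y : GL (Fin n) (AdeleRing (𝓞 K) K)))⁻¹ * x) ∂μ) =
      towerFun d φ w x * boxAverage (K := K) d β x := fun x => by
    unfold towerFun boxAverage
    ring
  simp_rw [he]
  exact lintegral_mul_boxAverage_eq hd hd0 ν (measurable_towerFun d hφ hw)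
    (fun p x => by
      obtain ⟨p₀, hp₀, hp₀e⟩ := (mem_ratPoints_iff _ _).1 p.2
      obtain ⟨hpt, hpc⟩ := Subgroup.mem_inf.1 hp₀
      unfold towerFun
      rw [← hp₀e, whittakerDepth_mul_left_of_mem hφK hd hpt hpc,
        hwK p₀ (tailUnipotent_mono (by omega) hpt) x])
    (fun u x => towerFun_colRange_mul hd hφK hwU u x) hβm hβ

/-- **Iteration: `I^{(d)} = I^{(n-1)}`** for every `d ≤ n - 1` and a cuspidal `φ`, given a measurable
`Q_e(K)`-covering weight `β e` for every depth `e` (`towerIntegral_pred_eq`, downward induction).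
[cite: JacquetShalikaAJM1981, §4] -/
theorem towerIntegral_eq_top {φ : GL (Fin n) (AdeleRing (𝓞 K) K) → ℂ} (hφ : Continuous φ)
    (hφK : ∀ (γ₀ : GL (Fin n) K) (x : GL (Fin n) (AdeleRing (𝓞 K) K)),
      φ (Matrix.GeneralLinearGroup.map (algebraMap K (AdeleRing (𝓞 K) K)) γ₀ * x) = φ x)
    (hcusp : ∀ k, 0 < k → k < n → CuspConditionGL n K φ k)
    {w : GL (Fin n) (AdeleRing (𝓞 K) K) → ℝ≥0∞} (hw : Measurable w)
    (hwU : ∀ u : GL (Fin n) (AdeleRing (𝓞 K) K), u ∈ upperUnitriangular (Fin n) (AdeleRing (𝓞 K) K) → ∀ x, w (u * x) = w x)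
    (hwK : ∀ γ₀ : GL (Fin n) K, γ₀ ∈ tailUnipotent n K (n - 1) →
      ∀ x, w (Matrix.GeneralLinearGroup.map (algebraMap K (AdeleRing (𝓞 K) K)) γ₀ * x) = w x)
    (ν : Measure (GL (Fin n) (AdeleRing (𝓞 K) K))) [SFinite ν] [ν.IsMulLeftInvariant]
    {β : ℕ → GL (Fin n) (AdeleRing (𝓞 K) K) → ℝ≥0∞} (hβm : ∀ e, Measurable (β e))
    (hβ : ∀ e x, coveringSum ↥(ratPoints (tailUnipotent n K e)) (β e) x = 1) :
    ∀ (k d : ℕ), d + k = n - 1 →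
      ∫⁻ x, towerFun d φ w x * β d x ∂ν = ∫⁻ x, towerFun (n - 1) φ w x * β (n - 1) x ∂ν
  | 0, d, h => by rw [show d = n - 1 by omega]
  | k + 1, d, h => by
    have hd : d + 1 < n := by omega
    have step := towerIntegral_pred_eq hφ hφK hcusp hw hwU hwK ν hd (Nat.succ_pos d) (hβm (d + 1)) (hβ (d + 1))
      (hβm d) (hβ d)
    rw [Nat.add_sub_cancel] at step
    exact step.trans (towerIntegral_eq_top hφ hφK hcusp hw hwU hwK ν hβm hβ k (d + 1) (by omega))

/-- **The bottom of the tower equals the top for a cusp form**: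
`∫ ‖Φ_0‖² w β_0 dν = ∫ ‖φ‖² w β_{n-1} dν` (`Φ_0 = W_φ` the Whittaker transform, `Φ_{n-1} = φ`) — the
unfolding identity `Ψ(σ; W_φ, W̄_φ, Φ) = ∫_{P_n(K) \ GL_n(𝔸)} |φ|² Φ(e_n g) |det g|^σ dg` of the real-point
Rankin–Selberg method in covering-weight form, the equality case of `towerIntegral_zero_le`
(Jacquet–Shalika (1981), §4; Cogdell (2004), §2.3, Thm. 2.1). [cite: CogdellAnalyticTheory2004, §2.3 Thm. 2.1] -/
theorem towerIntegral_zero_eq {φ : GL (Fin n) (AdeleRing (𝓞 K) K) → ℂ} (hφ : Continuous φ)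
    (hφK : ∀ (γ₀ : GL (Fin n) K) (x : GL (Fin n) (AdeleRing (𝓞 K) K)),
      φ (Matrix.GeneralLinearGroup.map (algebraMap K (AdeleRing (𝓞 K) K)) γ₀ * x) = φ x)
    (hcusp : ∀ k, 0 < k → k < n → CuspConditionGL n K φ k)
    {w : GL (Fin n) (AdeleRing (𝓞 K) K) → ℝ≥0∞} (hw : Measurable w)
    (hwU : ∀ u : GL (Fin n) (AdeleRing (𝓞 K) K), u ∈ upperUnitriangular (Fin n) (AdeleRing (𝓞 K) K) → ∀ x, w (u * x) = w x)
    (hwK : ∀ γ₀ : GL (Fin n) K, γ₀ ∈ tailUnipotent n K (n - 1) →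
      ∀ x, w (Matrix.GeneralLinearGroup.map (algebraMap K (AdeleRing (𝓞 K) K)) γ₀ * x) = w x)
    (ν : Measure (GL (Fin n) (AdeleRing (𝓞 K) K))) [SFinite ν] [ν.IsMulLeftInvariant]
    {β : ℕ → GL (Fin n) (AdeleRing (𝓞 K) K) → ℝ≥0∞} (hβm : ∀ e, Measurable (β e))
    (hβ : ∀ e x, coveringSum ↥(ratPoints (tailUnipotent n K e)) (β e) x = 1) :
    ∫⁻ x, towerFun 0 φ w x * β 0 x ∂ν =
      ∫⁻ x, ENNReal.ofReal (‖φ x‖ ^ 2) * w x * β (n - 1) x ∂ν := by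
  have h := towerIntegral_eq_top hφ hφK hcusp hw hwU hwK ν hβm hβ (n - 1) 0 (by omega)
  have e : ∀ x, towerFun (n - 1) φ w x = ENNReal.ofReal (‖φ x‖ ^ 2) * w x := fun x => by
    unfold towerFun; rw [whittakerDepth_top]
  simp_rw [e] at h
  exact h

end Chain

/-! ### The Rankin–Selberg unfolding identity at a real point -/

section Unfolding

variable {n : ℕ} {K : Type} [Field K] [NumberField K]
variable [MeasurableSpace (GaloisRepresentations.ideleGroup K)] [BorelSpace (GaloisRepresentations.ideleGroup K)]

-- Borel structures: `adelicBorel` on `(AdelicGroupData.gl n K).Adelic` (the spelling of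
-- `RankinSelbergTorusIntegral`) and `glAdeleBorel` of `SiegelSetVolume` on the definitionally equal
-- `GL (Fin n) (AdeleRing (𝓞 K) K)` (the spelling of the Whittaker tower), as in
-- `RankinSelbergTowerComparison` and `RankinSelbergEisensteinWeight`.
attribute [local instance] adelicBorel borelSpace_adelic glAdeleBorel borelSpace_glAdele

/-- **The bottom of the tower of a cusp form is the incomplete-Eisenstein integral**: for `0 < n`, `ν`
left invariant and s-finite, `φ` continuous, left `GL_n(K)`-invariant and cuspidal, `Φ` with
`g ↦ Φ(e_n g)` measurable, `σ ∈ ℝ`, a measurable `Q_e(K)`-covering weight `β e` for every depth `e` and a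
measurable `GL_n(K)`-covering weight `β_G`,

  `∫ towerFun 0 φ (rsWeight Φ σ) · β 0 dν = ∫ ‖φ‖² · eisensteinWeight Φ σ · β_G dν`

(`towerIntegral_zero_eq` with the Rankin–Selberg weight `w = Φ(e_n g) |det g|^σ`, left `N_n(𝔸_K)`- and
`P_n(K)`-invariant, and the unfolding of the mirabolic weight `lintegral_normSq_mul_rsWeight_mul_eq`):
Cogdell's `∫_{P_n(K)\GL_n(𝔸)} |φ|² Φ(e_n g)|det g|^σ dg = ∫_{GL_n(K)\GL_n(𝔸)} |φ|² Σ_γ (Φ |det|^σ)(γ g) dg`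
continued down the tower to the Whittaker function. [cite: CogdellAnalyticTheory2004, §2.3 Thm. 2.1] -/
theorem lintegral_towerFun_zero_rsWeight_eq_lintegral_eisensteinWeight (hn : 0 < n)
    (ν : Measure (GL (Fin n) (AdeleRing (𝓞 K) K))) [SFinite ν] [ν.IsMulLeftInvariant]
    {φ : GL (Fin n) (AdeleRing (𝓞 K) K) → ℂ} (hφ : Continuous φ)
    (hφK : ∀ (γ₀ : GL (Fin n) K) (x : GL (Fin n) (AdeleRing (𝓞 K) K)),
      φ (Matrix.GeneralLinearGroup.map (algebraMap K (AdeleRing (𝓞 K) K)) γ₀ * x) = φ x)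
    (hcusp : ∀ k, 0 < k → k < n → CuspConditionGL n K φ k)
    {Φ : (Fin n → AdeleRing (𝓞 K) K) → ℝ}
    (hΦl : Measurable fun g : GL (Fin n) (AdeleRing (𝓞 K) K) => Φ (lastRow n K g)) (σ : ℝ)
    {β : ℕ → GL (Fin n) (AdeleRing (𝓞 K) K) → ℝ≥0∞} (hβm : ∀ e, Measurable (β e))
    (hβ : ∀ e x, coveringSum ↥(ratPoints (tailUnipotent n K e)) (β e) x = 1)
    {βG : GL (Fin n) (AdeleRing (𝓞 K) K) → ℝ≥0∞} (hβGm : Measurable βG)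
    (hβG : ∀ x, coveringSum ↥(ratPoints (⊤ : Subgroup (GL (Fin n) K))) βG x = 1) :
    ∫⁻ x, towerFun 0 φ (rsWeight n K Φ σ) x * β 0 x ∂ν =
      ∫⁻ x, ENNReal.ofReal (‖φ x‖ ^ 2) * eisensteinWeight n K Φ σ x * βG x ∂ν := by
  have hw : Measurable (rsWeight n K Φ σ) := measurable_rsWeight hΦl σ
  rw [towerIntegral_zero_eq hφ hφK hcusp hw (fun u hu x => rsWeight_unipotent_mul Φ σ hu x)
    (fun γ₀ hγ x => rsWeight_ratMirabolic_mul Φ σ hγ x) ν hβm hβ]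
  exact lintegral_normSq_mul_rsWeight_mul_eq hn ν hφ hφK hΦl σ (hβm (n - 1)) (hβ (n - 1)) hβGm hβG

/-- **The Rankin–Selberg unfolding identity at a real point** (Jacquet–Shalika (1981), §4; Cogdell
(2004), §2.3, Thm. 2.1 for `φ' = φ̄`, in the tree's normalisations). Let `0 < n`, `ν` a Haar measure on
`GL_n(𝔸_K)`, `νA` a Haar measure on `(𝔸_Kˣ)ⁿ`, `νK` a Haar measure on `K = maximalCompactAdelic n K` and `ν₀`
a Haar measure on `N_n(𝔸_K)`. There is `C ∈ (0, ∞)`, depending only on the measures (the Iwasawa constant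
of `lintegral_towerFun_zero_rsWeight_eq_whittakerCoeff`), such that for every `φ : GL_n(𝔸_K) → ℂ`
continuous, left `GL_n(K)`-invariant and **cuspidal** (`CuspConditionGL n K φ k`, `0 < k < n`), every
`Φ ≥ 0` with `g ↦ Φ(e_n g)` measurable, every `σ ∈ ℝ` and every measurable `GL_n(K)`-covering weight `β_G`:

  `C · rankinSelbergTorusIntegral νA νK W_φ Φ σ = ∫ ‖φ‖² · eisensteinWeight Φ σ · β_G dν`

in `[0, ∞]`, where `W_φ = whittakerCoeff ν₀ (unipotentTateDomain n K) (adeleAddChar K) φ` is the global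
Whittaker coefficient: `Ψ(σ; W_φ, W̄_φ, Φ) = ∫_{GL_n(K)\GL_n(𝔸_K)} |φ(g)|² E_w(g) dg` with
`E_w(g) = Σ_{v ∈ Kⁿ∖0} Φ(v g) |det g|^σ` the incomplete Eisenstein sum (before the integration over the
centre producing `E(g, Φ; s)`). The mean-square method of the tree had `≤`
(`rankinSelbergTorusIntegral_whittakerCoeff_ne_top`); equality is Parseval plus cuspidality.
[cite: CogdellAnalyticTheory2004, §2.3 Thm. 2.1] -/
theorem exists_mul_rankinSelbergTorusIntegral_eq_lintegral_eisensteinWeight (hn : 0 < n)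
    (ν : Measure (GL (Fin n) (AdeleRing (𝓞 K) K))) [IsHaarMeasure ν]
    (νA : Measure (Fin n → GaloisRepresentations.ideleGroup K)) [IsHaarMeasure νA]
    (νK : Measure ↥(maximalCompactAdelic n K)) [IsHaarMeasure νK]
    (ν₀ : Measure ↥(adelicUnipotent n K)) [IsHaarMeasure ν₀] :
    ∃ C : ℝ≥0∞, C ≠ 0 ∧ C ≠ ⊤ ∧
      ∀ {φ : GL (Fin n) (AdeleRing (𝓞 K) K) → ℂ}, Continuous φ →
        (∀ (γ₀ : GL (Fin n) K) (x : GL (Fin n) (AdeleRing (𝓞 K) K)),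
          φ (Matrix.GeneralLinearGroup.map (algebraMap K (AdeleRing (𝓞 K) K)) γ₀ * x) = φ x) →
        (∀ k, 0 < k → k < n → CuspConditionGL n K φ k) →
      ∀ {Φ : (Fin n → AdeleRing (𝓞 K) K) → ℝ}, (∀ y, 0 ≤ Φ y) →
        (Measurable fun g : GL (Fin n) (AdeleRing (𝓞 K) K) => Φ (lastRow n K g)) →
      ∀ (σ : ℝ) {βG : GL (Fin n) (AdeleRing (𝓞 K) K) → ℝ≥0∞}, Measurable βG →
        (∀ x, coveringSum ↥(ratPoints (⊤ : Subgroup (GL (Fin n) K))) βG x = 1) →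
        C * rankinSelbergTorusIntegral n K νA νK
            (whittakerCoeff ν₀ (unipotentTateDomain n K) (adeleAddChar K) φ) Φ σ =
          ∫⁻ x, ENNReal.ofReal (‖φ x‖ ^ 2) * eisensteinWeight n K Φ σ x * βG x ∂ν := by
  haveI : T2Space (GL (Fin n) (AdeleRing (𝓞 K) K)) := t2Space_gl n K
  haveI : LocallyCompactSpace (GL (Fin n) (AdeleRing (𝓞 K) K)) :=
    AdelicGroupData.locallyCompactSpace_generalLinearGroup_adeleRing K (Fin n)
  haveI : SecondCountableTopology (GL (Fin n) (AdeleRing (𝓞 K) K)) :=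
    secondCountableTopology_generalLinearGroup_adeleRing K (Fin n)
  obtain ⟨β, hβ⟩ := exists_isCoveringWeight_tail (n := n) (K := K)
  obtain ⟨C, hC0, hCtop, hcmp⟩ := lintegral_towerFun_zero_rsWeight_eq_whittakerCoeff (n := n) (K := K) hn ν νA νK ν₀
  refine ⟨C, hC0, hCtop, fun {φ} hφ hφK hcusp {Φ} hΦ0 hΦm σ {βG} hβGm hβG => ?_⟩
  rw [← hcmp hφ hφK hΦ0 hΦm σ (hβ 0).1 (hβ 0).2]
  exact lintegral_towerFun_zero_rsWeight_eq_lintegral_eisensteinWeight hn ν hφ hφK hcusp hΦm σ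
    (fun e => (hβ e).1) (fun e => (hβ e).2) hβGm hβG

end Unfolding

end Literature.NumberTheory.Automorphic
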